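import Literature.AlgebraicGeometry.HodgeTheory.MotivatedClassesCupPairingNondegenerate
import Literature.AlgebraicGeometry.HodgeTheory.MotivatedClassesDeformationLeaves
import Literature.AlgebraicGeometry.HodgeTheory.MotivatedClassesAlgebraic
import Literature.AlgebraicGeometry.HodgeTheory.CycleClassVanishingOfHodgePairing
import Literature.AlgebraicGeometry.Motives.AbelianVarietyExistence
import Literature.AlgebraicGeometry.Motives.AbelianVarietyProductDimProofs
import HarnessLib

/-!
# André 1996, §5.1: a class whose pull-back along `j : X ⟶ X̄` is motivated has a motivated representative modulo
# `ker j^*` — the named fact `HodgeTheory.Andre1996_exists_motivated_of_motivated_pullback` HOLDS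

The named fact (`HodgeTheory/MotivatedClassesDeformationLeaves`, leaf (A3) of André's deformation theorem
`Andre1996_deformation` = Y. André, *Pour une théorie inconditionnelle des motifs*, Publ. Math. IHÉS 83 (1996), Thm. 0.5,
proof §5.1 p. 25 via Thm. 0.4: «Puisque la catégorie des motifs est abélienne (0.4) … en fait, `ξ_s` provient d'un cycle
motivé sur `X̄`»): for a morphism `j : X ⟶ X̄` of smooth projective complex varieties and `Ā ∈ H²ᵖ(X̄(ℂ); ℂ)` with `j^* Ā`
motivated, there is a MOTIVATED `Ā'` with `j^* Ā' = j^* Ā`. In print this is the semisimplicity of motivated motives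
(Thm. 0.4, resting on Prop. 3.3). Here it is derived from the part of Prop. 3.3 proved on the real carriers — «≡ est
l'égalité sur `A_mot(X)`», the non-degeneracy of the cup pairing on motivated classes
(`HodgeTheory/MotivatedClassesCupPairingNondegenerate`) — by a duality argument that needs no category of motives: with
`W = j^*(A_motᵖ(X̄)) ⊆ A_motᵖ(X)`, the annihilator `W^⊥ ⊆ A_mot^{n-p}(X)` consists of the motivated `b` with
`j_* b ⟂ A_motᵖ(X̄)` (projection formula `⟨j^* a ∪ b⟩ = ⟨a ∪ j_* b⟩`, the tree's `cupPairing_gysinMap`), i.e. with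
`j_* b = 0` (non-degeneracy on `X̄`, `j_*` preserves `A_mot`); hence `j^* Ā ⟂ W^⊥`, and `W^⊥⊥ = W` inside the
non-degenerately paired `A_motᵖ(X) × A_mot^{n-p}(X)`.

* Part 1 — algebraic correspondences preserve motivated classes (André's Corollaire p. 15 for ALGEBRAIC
  correspondences): `corrClassAction_mem_motivatedClasses` (`γ^*(A_motᵖ(X)_ℂ) ⊆ A_mot^{p'}(W)_ℂ` for `γ` algebraic on
  `W ⊗ X`), `map_mem_motivatedClasses_of_isAlgebraicCorrespondence`, `complexGysin_mem_motivatedClasses` (`f_*`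
  preserves motivated classes: the Gysin morphism is induced by the transposed graph);
* Part 2 §1 linear algebra: `mem_of_forall_orthogonal` (`W^⊥⊥ = W` for a pairing into a line, non-degenerate between
  two finite-dimensional subspaces); `cupProduct_eq_zero_of_cupPairing_eq_zero` (`⟨t, [X(ℂ)]⟩ = 0 ⟹ t = 0` in the top
  degree, the tree's `HodgeTheory.eq_zero_of_kroneckerPairing_fundamentalClass_eq_zero`); `finrank_complexBetti_top`;
* Part 2 §2 **`Literature.AlgebraicGeometry.HodgeTheory.Andre1996_exists_motivated_of_motivated_pullback_holds`** — the
  named fact, PROVED under its exact name; hence André's deformation theorem `Andre1996_deformation` holds modulo the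
  three remaining published inputs {Mumford's curve lemma (A0), Hironaka's smooth compactification (A1), Deligne's
  théorème de la partie fixe `deligne_globalInvariantCycles` (A2)} (`Andre1996_deformation_holds_of_inputs`; (A5)
  `Andre1996_motivatedClasses_pullback` is `MotivatedPullback`'s `Andre1996_motivatedClasses_pullback_holds`).

Theorems only: no definition, no NEW named fact (net: one Literature named fact discharged under its exact name).

Provenance: Literature home (namespace `Literature.AlgebraicGeometry.HodgeTheory.MotivatedAlgebra`) of the
Summits-side `HodgeConjecture/Theorems/Ring2HypothesesDescentMotivatedPullbackLift` (Part 2) and of §1 of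
`…/Ring2HypothesesDescentMotivatedCorrespondences` (Part 1) (imports `Literature/` and Mathlib only), the last layer of
the Literature-side proof chain `LefschetzCrossMonomialBlocks → LefschetzCrossBlocksHardLefschetz →
LefschetzStarExternalProductBetti → MotivatedClassesCupProduct → LefschetzStarSelfAdjointStringTop →
MotivatedClassesLefschetzStarStable → MotivatedClassesCupPairingNondegenerate → MotivatedPullbackLiftHolds`.
Lane `lit-hodgefound`, seat p20.

## References

* [Andre1996Motifs] Y. André, *Pour une théorie inconditionnelle des motifs*, Publ. Math. IHÉS 83 (1996), Thm. 0.4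
  (p. 7), Thm. 0.5 (p. 8), §2.1 Prop. 2.1 and Corollaire (pp. 14–15), Prop. 3.3 (pp. 21–22), §5.1 (p. 25).
* [Jannsen1992] U. Jannsen, *Motives, numerical equivalence, and semi-simplicity*, Invent. Math. 107 (1992), Lemma 2
  (the semisimplicity argument this file avoids).
* [FultonYoungTableaux1997] W. Fulton, *Young Tableaux* (1997), App. B §B.1 (2), (5)–(6).
* [VoisinHodgeII2003] C. Voisin, *Hodge Theory and Complex Algebraic Geometry II* (2003), §9.2.4 Prop. 9.20–9.21.
* [HatcherAT2002] A. Hatcher, *Algebraic Topology* (2002), §3.3 Thm. 3.26, Thm. 3.30, Cor. 3.37, Prop. 3.38.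
* [DeligneHodgeII1971] P. Deligne, *Théorie de Hodge II*, Publ. Math. IHÉS 40 (1971), Thm. 4.1.1.
-/

noncomputable section

namespace Literature.AlgebraicGeometry.HodgeTheory.MotivatedAlgebra

open _root_.CategoryTheory _root_.AlgebraicGeometry MonoidalCategory CartesianMonoidalCategory
open Literature.AlgebraicTopology.SingularHomology Literature.Geometry.Kaehler
open Literature.AlgebraicGeometry Literature.AlgebraicGeometry.Motives
open Literature.AlgebraicGeometry.HodgeTheory.MotivatedPullback

/-! ## Part 1: Algebraic correspondences and Gysin maps preserve motivated classes -/

section Part1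

variable {m n : ℕ} {W X : SchemeOver ℂ}

/-- **`γ^*(A_motᵖ(X)_ℂ) ⊆ A_mot^{p'}(W)_ℂ` for an algebraic class `γ ∈ Nᵉ H²ᵉ((W ⊗ X)(ℂ); ℂ)`** (André 1996, Prop. 2.1
and its Corollaire, p. 15, for ALGEBRAIC correspondences): `γ^* c = pr_{W*}(pr_X^* c ∪ γ)` (`corrClassAction`, any
orientations with Poincaré duality) with `pr_X^* c` motivated (Prop. 2.1 (ii), first inclusion —
`MotivatedPullback.map_snd_mem_motivatedClasses`), `· ∪ γ` motivated (`cupProduct_mem_motivatedClasses_of_cupProduct_algebraic`,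
the multiplicativity of algebraic classes being the theorem `Voisin2003_cupProduct_algebraicClasses_holds'`) and `pr_{W*}`
preserving motivated classes (Prop. 2.1 (ii), second inclusion, `gysinMap_fst_mem_motivatedClasses`). Degrees:
`2p + 2e = 2p' + 2n`, `2p' + 2q = 2m`. [cite: Andre1996Motifs, Prop. 2.1 and Corollaire (pp. 14–15)]
[cite: VoisinHodgeII2003, §9.2.4 Prop. 9.20–9.21] -/
theorem corrClassAction_mem_motivatedClasses (hW : IsSmoothProjective m W) (hX : IsSmoothProjective n X)
    (μ : HomologicalOrientation ℂ (ComplexPoints (W ⊗ X)) (2 * (m + n)))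
    (ν : HomologicalOrientation ℂ (ComplexPoints W) (2 * m)) (hμ : μ.HasPoincareDuality) (hν : ν.HasPoincareDuality)
    {e p p' q : ℕ} (hab : 2 * p + 2 * e = 2 * p' + 2 * n) (hq : 2 * p' + 2 * q = 2 * m)
    {γ : complexBetti (W ⊗ X) (2 * e)} (hγ : γ ∈ algebraicClasses (W ⊗ X) e) {c : complexBetti X (2 * p)}
    (hc : c ∈ motivatedClasses n X p) : corrClassAction μ ν hab hq γ c ∈ motivatedClasses m W p' := by
  have hWX : IsSmoothProjective (m + n) (W ⊗ X) := IsSmoothProjective.tensor_holds hW hX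
  rw [corrClassAction_apply]
  have hsnd : complexBetti.map (snd W X) (2 * p) c ∈ motivatedClasses (m + n) (W ⊗ X) p :=
    map_snd_mem_motivatedClasses hX hW p hc
  have hcupm : ∀ (k : ℕ) (_ : p + e = k) (h2 : 2 * p + 2 * e = 2 * k),
      cupProduct h2 (complexBetti.map (snd W X) (2 * p) c) γ ∈ motivatedClasses (m + n) (W ⊗ X) k := by
    rintro k rfl h2
    exact cupProduct_mem_motivatedClasses_of_cupProduct_algebraic Voisin2003_cupProduct_algebraicClasses_holds' hWX
      h2 hsnd hγ
  have hk := hcupm (p' + n) (by omega) (by omega)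
  -- degree bookkeeping `2p + 2e = 2(p' + n)`
  have key : ∀ {D : ℕ} (hD : 2 * p + 2 * e = D) (e1 : D + 2 * q = 2 * (m + n)),
      gysinMap μ ν (AlgPoints.mapContinuous (L := ℂ) (fst W X)) e1 hq
          (cupProduct hD (complexBetti.map (snd W X) (2 * p) c) γ) =
        gysinMap μ ν (AlgPoints.mapContinuous (L := ℂ) (fst W X))
          (show 2 * p + 2 * e + 2 * q = 2 * (m + n) by omega) hq
          (cupProduct rfl (complexBetti.map (snd W X) (2 * p) c) γ) := by
    rintro D rfl e1
    rfl
  rw [← key (show 2 * p + 2 * e = 2 * (p' + n) by omega) (show 2 * (p' + n) + 2 * q = 2 * (m + n) by omega)]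
  exact gysinMap_fst_mem_motivatedClasses hW hX μ ν hμ hν _ hq hk

/-- **Maps induced by algebraic correspondences preserve motivated classes**: if
`T : H²ᵖ(X(ℂ); ℂ) → H^{2p'}(W(ℂ); ℂ)` is induced by an algebraic correspondence (`IsAlgebraicCorrespondence m n W X T`),
then `T(A_motᵖ(X)_ℂ) ⊆ A_mot^{p'}(W)_ℂ` (unpack the correspondence and apply `corrClassAction_mem_motivatedClasses`; the
homological degree `q` of the correspondence is even, `2p' + q = 2m`).
[cite: Andre1996Motifs, Prop. 2.1 and Corollaire (pp. 14–15)] -/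
theorem map_mem_motivatedClasses_of_isAlgebraicCorrespondence (hW : IsSmoothProjective m W)
    (hX : IsSmoothProjective n X) {p p' : ℕ} {T : complexBetti X (2 * p) →ₗ[ℂ] complexBetti W (2 * p')}
    (hT : IsAlgebraicCorrespondence m n W X T) {c : complexBetti X (2 * p)} (hc : c ∈ motivatedClasses n X p) :
    T c ∈ motivatedClasses m W p' := by
  obtain ⟨μ, ν, hμ, hν, e, q, hab, hq, γ, hγ, hTeq⟩ := hT
  rw [← hTeq]
  obtain ⟨q', rfl⟩ : ∃ q', q = 2 * q' := ⟨m - p', by omega⟩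
  exact corrClassAction_mem_motivatedClasses hW hX μ ν hμ hν hab hq hγ hc

/-- **`f_*(A_motᵖ(X')_ℂ) ⊆ A_mot^{p'}(X)_ℂ` for every morphism `f : X' ⟶ X`** of smooth projective complex varieties
(dimensions `m`, `n`; `2p + 2n = 2p' + 2m`): the Gysin morphism `complexGysin μ` of any orientation family is induced
by the transposed graph (`isAlgebraicCorrespondence_complexGysin`), an algebraic correspondence (André p. 15: "en
composant … avec la classe du graphe de `f` ou sa transposée"). [cite: Andre1996Motifs, §2.1 (p. 15)]
[cite: FultonYoungTableaux1997, Appendix B §B.1 (5)] -/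
theorem complexGysin_mem_motivatedClasses (μ : OrientationFamily) {X' : SchemeOver ℂ}
    (hX' : IsSmoothProjective m X') (hX : IsSmoothProjective n X) (f : X' ⟶ X) {p p' : ℕ}
    (hab : 2 * p + 2 * n = 2 * p' + 2 * m) (hp' : p' ≤ n) {c : complexBetti X' (2 * p)}
    (hc : c ∈ motivatedClasses m X' p) : complexGysin μ hX' hX f hab c ∈ motivatedClasses n X p' :=
  map_mem_motivatedClasses_of_isAlgebraicCorrespondence hX hX'
    (isAlgebraicCorrespondence_complexGysin μ (OrientationFamily.hasPoincareDuality μ) hX' hX f hab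
      (show 2 * p' + (2 * n - 2 * p') = 2 * n by omega)) hc

end Part1

/-! ## Part 2: The lift: `Andre1996_exists_motivated_of_motivated_pullback` holds -/

section Part2

/-! ## §1 Linear algebra and the top-degree Kronecker pairing -/

/-- **`W^⊥⊥ = W` for a pairing into a line.** Let `B : M × N → T`, `dim T = 1`, be non-degenerate between the
finite-dimensional subspaces `V ≤ M` and `V' ≤ N` (trivial left kernel on `V` against `V'`, trivial right kernel on
`V'` against `V`), `W ≤ V`, and `x ∈ V` with `B(x, b) = 0` for every `b ∈ V'` annihilating `W`. Then `x ∈ W`: every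
`T`-valued functional on `V` is `B(·, b)|_V` for some `b ∈ V'` (injective maps between spaces of equal dimension), in
particular one killing `W` but not `x` if `x ∉ W`. [cite: Andre1996Motifs, §5.1 (p. 25)] -/
theorem mem_of_forall_orthogonal {K M N T : Type*} [Field K] [AddCommGroup M] [Module K M] [AddCommGroup N]
    [Module K N] [AddCommGroup T] [Module K T] [FiniteDimensional K M] [FiniteDimensional K N]
    [FiniteDimensional K T] (hT : Module.finrank K T = 1) (B : M →ₗ[K] N →ₗ[K] T) (V : Submodule K M)
    (V' : Submodule K N) (h₁ : ∀ v ∈ V, (∀ w ∈ V', B v w = 0) → v = 0)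
    (h₂ : ∀ w ∈ V', (∀ v ∈ V, B v w = 0) → w = 0) {W : Submodule K M} (hW : W ≤ V) {x : M} (hx : x ∈ V)
    (hxW : ∀ b ∈ V', (∀ w ∈ W, B w b = 0) → B x b = 0) : x ∈ W := by
  classical
  set Φ : V →ₗ[K] (V' →ₗ[K] T) := B.domRestrict₁₂ V V' with hΦdef
  set Ψ : V' →ₗ[K] (V →ₗ[K] T) := (B.domRestrict₁₂ V V').flip with hΨdef
  have hΦ : Function.Injective Φ := by
    rw [injective_iff_map_eq_zero]
    intro v hv
    exact Subtype.ext (h₁ v v.2 fun w hw ↦ by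
      simpa [hΦdef, LinearMap.domRestrict₁₂_apply] using LinearMap.congr_fun hv ⟨w, hw⟩)
  have hΨ : Function.Injective Ψ := by
    rw [injective_iff_map_eq_zero]
    intro w hw
    exact Subtype.ext (h₂ w w.2 fun v hv ↦ by
      simpa [hΨdef, LinearMap.domRestrict₁₂_apply] using LinearMap.congr_fun hw ⟨v, hv⟩)
  have hWT : Module.finrank K (V' →ₗ[K] T) = Module.finrank K V' := by
    rw [Module.finrank_linearMap, hT, mul_one]
  have hVT : Module.finrank K (V →ₗ[K] T) = Module.finrank K V := by
    rw [Module.finrank_linearMap, hT, mul_one]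
  have h1 := LinearMap.finrank_le_finrank_of_injective hΦ
  have h2 := LinearMap.finrank_le_finrank_of_injective hΨ
  rw [hWT] at h1
  rw [hVT] at h2
  have hsurj : Function.Surjective Ψ :=
    (LinearMap.injective_iff_surjective_of_finrank_eq_finrank (by rw [hVT]; omega)).1 hΨ
  by_contra hxW'
  -- a functional on `V` killing `W` but not `x`
  set WV : Submodule K V := W.comap V.subtype with hWV
  have hx' : (⟨x, hx⟩ : V) ∉ WV := fun h ↦ hxW' (by simpa [hWV] using h)
  obtain ⟨f, hfx, hfW⟩ := Submodule.exists_dual_map_eq_bot_of_notMem hx' inferInstance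
  obtain ⟨t₀, ht₀⟩ : ∃ t₀ : T, t₀ ≠ 0 := Module.finrank_pos_iff_exists_ne_zero.mp (by rw [hT]; exact one_pos)
  obtain ⟨b, hb⟩ := hsurj ((LinearMap.toSpanSingleton K T t₀) ∘ₗ f)
  have hbv : ∀ v : V, B v b = f v • t₀ := fun v ↦ by
    have := LinearMap.congr_fun hb v
    simpa [hΨdef, LinearMap.domRestrict₁₂_apply] using this
  have hbW : ∀ w ∈ W, B w b = 0 := by
    intro w hw
    have hwV : (⟨w, hW hw⟩ : V) ∈ WV := by simpa [hWV] using hw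
    have hfw : f ⟨w, hW hw⟩ = 0 := by
      have : f ⟨w, hW hw⟩ ∈ WV.map f := Submodule.mem_map_of_mem hwV
      rwa [hfW, Submodule.mem_bot] at this
    rw [show B w b = B ((⟨w, hW hw⟩ : V) : M) b from rfl, hbv, hfw, zero_smul]
  have hxb := hxW b b.2 hbW
  rw [show B x b = B ((⟨x, hx⟩ : V) : M) b from rfl, hbv] at hxb
  exact (smul_ne_zero hfx ht₀) hxb

variable {n : ℕ} {X : SchemeOver ℂ}

/-- `ξ ∪ y = 0` as soon as `⟨ξ ∪ y, [X(ℂ)]⟩ = 0` for the complex orientation (the Kronecker pairing with the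
fundamental class is injective on the top degree of the connected closed manifold `X(ℂ)`:
`HodgeTheory.eq_zero_of_kroneckerPairing_fundamentalClass_eq_zero`), in the `cupPairing` spelling.
[cite: HatcherAT2002, §3.3 Thm. 3.26 and p. 249] -/
theorem cupProduct_eq_zero_of_cupPairing_eq_zero (hX : IsSmoothProjective n X) {a b : ℕ}
    (h : a + b = 2 * n) {ξ : complexBetti X a} {y : complexBetti X b}
    (h0 : cupPairing (complexOrientationFamily hX) h ξ y = 0) : cupProduct h ξ y = 0 :=
  eq_zero_of_kroneckerPairing_fundamentalClass_eq_zero hX (by rwa [cupPairing_apply] at h0)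

/-- **`H²ⁿ(X(ℂ); ℂ)` is a line** for `X` smooth projective of dimension `n` (Poincaré duality `dim H²ⁿ = dim H⁰`,
Hatcher Cor. 3.37, and `H⁰ ≅ ℂ` for the path-connected `X(ℂ)`); same statement as the tree's
`finrank_complexBetti_two_mul_eq_one`, re-proved here to keep the imports light.
[cite: HatcherAT2002, §3.3 Cor. 3.37 and §3.1 p. 199] -/
theorem finrank_complexBetti_top (hX : IsSmoothProjective n X) :
    Module.finrank ℂ (complexBetti X (2 * n)) = 1 := by
  haveI := pathConnectedSpace_complexPoints hX
  change Module.finrank ℂ (singularCohomology ℂ ℂ (ComplexPoints X) (2 * n)) = 1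
  rw [ComplexPoints.finrank_singularCohomology_eq_of_add_eq ℂ hX (show 2 * n + 0 = 2 * n by omega),
    (singularCohomologyZeroEquiv ℂ ℂ (ComplexPoints X)).finrank_eq, Module.finrank_self]

/-! ## §2 The discharge -/

/-- **DISCHARGE of `Andre1996_exists_motivated_of_motivated_pullback`** (leaf (A3) of André's deformation theorem;
André 1996 §5.1 via Thm. 0.4). For `j : X ⟶ X̄` (smooth projective, dimensions `n`, `m`) and `Ā ∈ H²ᵖ(X̄(ℂ); ℂ)` with
`j^* Ā ∈ A_motᵖ(X)_ℂ`, there is `Ā' ∈ A_motᵖ(X̄)_ℂ` with `j^* Ā' = j^* Ā`. Proof: `W := j^*(A_motᵖ(X̄)) ≤ A_motᵖ(X)`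
(Prop. 2.1 (ii), `Andre1996_motivatedClasses_pullback_holds`); for `b ∈ A_mot^{n-p}(X)` cup-orthogonal to `W`,
`j_* b ∈ A_mot^{m-p}(X̄)` (`complexGysin_mem_motivatedClasses`) is cup-orthogonal to `A_motᵖ(X̄)` by the projection
formula `⟨j_* b ∪ a, [X̄]⟩ = ⟨b ∪ j^* a, [X]⟩` (`cupPairing_gysinMap`), hence `j_* b = 0` (André Prop. 3.3 on `X̄`,
`nondegenerate_motivatedClasses`), hence `⟨j^* Ā ∪ b⟩ = ⟨Ā ∪ j_* b⟩ = 0`; so `j^* Ā ∈ W^⊥⊥ = W` (Prop. 3.3 on `X`,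
`mem_of_forall_orthogonal`). Degrees `p > n` or `p > m` are trivial (`H²ᵖ = 0`).
[cite: Andre1996Motifs, §5.1 (p. 25), Thm. 0.4 (p. 7) and Prop. 3.3 (pp. 21–22)]
[cite: FultonYoungTableaux1997, Appendix B §B.1 (5)–(6)] [cite: HatcherAT2002, §3.3 Thm. 3.30] -/
theorem _root_.Literature.AlgebraicGeometry.HodgeTheory.Andre1996_exists_motivated_of_motivated_pullback_holds :
    Andre1996_exists_motivated_of_motivated_pullback := by
  intro m n Xbar X j hXbar hX p Ā hĀ
  classical
  -- trivial degrees
  by_cases hpn : n < p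
  · haveI := subsingleton_complexBetti hX (show 2 * n < 2 * p by omega)
    exact ⟨0, Submodule.zero_mem _, by rw [map_zero]; exact Subsingleton.elim _ _⟩
  by_cases hpm : m < p
  · haveI := subsingleton_complexBetti hXbar (show 2 * m < 2 * p by omega)
    exact ⟨0, Submodule.zero_mem _, by rw [Subsingleton.elim Ā 0]⟩
  obtain ⟨q, hq⟩ : ∃ q, p + q = n := ⟨n - p, by omega⟩
  obtain ⟨q', hq'⟩ : ∃ q', p + q' = m := ⟨m - p, by omega⟩
  -- orientations and the Gysin morphism `j_* : H^{2q}(X) → H^{2q'}(X̄)`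
  have hPD := hasPoincareDuality_complexOrientationFamily
  have hab : 2 * q + 2 * m = 2 * q' + 2 * n := by omega
  have hgys : complexGysin complexOrientationFamily hX hXbar j hab =
      gysinMap (complexOrientationFamily hX) (complexOrientationFamily hXbar) (AlgPoints.mapContinuous (L := ℂ) j)
        (show 2 * q + 2 * p = 2 * n by omega) (show 2 * q' + 2 * p = 2 * m by omega) :=
    complexGysin_eq_gysinMap hX hXbar j hab _ _
  -- the subspace `W = j^*(A_motᵖ(X̄))` of `A_motᵖ(X)`
  set W : Submodule ℂ (complexBetti X (2 * p)) := (motivatedClasses m Xbar p).map (complexBetti.map j (2 * p)).hom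
    with hWdef
  have hWle : W ≤ motivatedClasses n X p := by
    rintro _ ⟨a, ha, rfl⟩
    exact Andre1996_motivatedClasses_pullback_holds j hXbar hX p a ha
  -- finite-dimensionality and the line `H^{2n}(X(ℂ); ℂ)`
  haveI := finite_complexBetti hX (2 * p)
  haveI := finite_complexBetti hX (2 * q)
  haveI := finite_complexBetti hX (2 * n)
  obtain ⟨hD₁, hD₂⟩ := nondegenerate_motivatedClasses hX hq
  obtain ⟨-, hD₂'⟩ := nondegenerate_motivatedClasses hXbar hq'
  have hmem : complexBetti.map j (2 * p) Ā ∈ W := by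
    refine mem_of_forall_orthogonal (finrank_complexBetti_top hX)
      (cupProduct (show 2 * p + 2 * q = 2 * n by omega)) (motivatedClasses n X p) (motivatedClasses n X q) hD₁ hD₂
      hWle hĀ fun b hb hbW ↦ ?_
    -- `j_* b` is motivated and cup-orthogonal to `A_motᵖ(X̄)`, hence zero
    have hjb : complexGysin complexOrientationFamily hX hXbar j hab b ∈ motivatedClasses m Xbar q' :=
      complexGysin_mem_motivatedClasses complexOrientationFamily hX hXbar j hab (by omega) hb
    have hjb0 : complexGysin complexOrientationFamily hX hXbar j hab b = 0 := by
      refine hD₂' _ hjb fun ξ hξ ↦ ?_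
      refine cupProduct_eq_zero_of_cupPairing_eq_zero hXbar _ ?_
      rw [cupPairing_apply, cupProduct_gradedComm_holds ℂ (ComplexPoints Xbar) (show 2 * p + 2 * q' = 2 * m by omega)
          (show 2 * q' + 2 * p = 2 * m by omega) ξ _,
        show ((-1 : ℂ) ^ (2 * p * (2 * q'))) = 1 by
          rw [show 2 * p * (2 * q') = 2 * (p * (2 * q')) by ring, pow_mul, neg_one_sq, one_pow], one_smul,
        ← cupPairing_apply, hgys, cupPairing_gysinMap (hPD hXbar),
        cupPairing_apply, cupProduct_gradedComm_holds ℂ (ComplexPoints X) (show 2 * q + 2 * p = 2 * n by omega)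
          (show 2 * p + 2 * q = 2 * n by omega) b _,
        show ((-1 : ℂ) ^ (2 * q * (2 * p))) = 1 by
          rw [show 2 * q * (2 * p) = 2 * (q * (2 * p)) by ring, pow_mul, neg_one_sq, one_pow], one_smul,
        hbW _ ⟨ξ, hξ, rfl⟩, map_zero, LinearMap.zero_apply]
    -- hence `⟨j^* Ā ∪ b⟩ = ⟨Ā ∪ j_* b⟩ = 0`
    refine cupProduct_eq_zero_of_cupPairing_eq_zero hX _ ?_
    rw [cupPairing_apply, cupProduct_gradedComm_holds ℂ (ComplexPoints X) (show 2 * p + 2 * q = 2 * n by omega)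
        (show 2 * q + 2 * p = 2 * n by omega) _ b,
      show ((-1 : ℂ) ^ (2 * p * (2 * q))) = 1 by
        rw [show 2 * p * (2 * q) = 2 * (p * (2 * q)) by ring, pow_mul, neg_one_sq, one_pow], one_smul,
      ← cupPairing_apply, ← cupPairing_gysinMap (hPD hXbar) (AlgPoints.mapContinuous (L := ℂ) j)
        (show 2 * q + 2 * p = 2 * n by omega) (show 2 * q' + 2 * p = 2 * m by omega) b Ā, ← hgys, hjb0, map_zero,
      LinearMap.zero_apply]
  obtain ⟨Ā', hĀ', hj⟩ := hmem
  exact ⟨Ā', hĀ', hj⟩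

/-- **André's deformation theorem modulo three published inputs**: with (A3) discharged here and (A5) discharged by
`Andre1996_motivatedClasses_pullback_holds` (file `HodgeTheory/MotivatedClassesPullbackHolds`), the tree's named fact
`Andre1996_deformation` (André 1996 Thm. 0.5) follows from Mumford's curve lemma (A0), Hironaka's smooth compactification
(A1) and Deligne's théorème de la partie fixe `deligne_globalInvariantCycles` (A2) alone (`Andre1996_deformation_holds_of`).
[cite: Andre1996Motifs, Thm. 0.5 (p. 8) and §5.1 (p. 25)] [cite: DeligneHodgeII1971, Théorème 4.1.1] -/
theorem Andre1996_deformation_holds_of_inputs (hcurve : Mumford_curveLemma_affine)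
    (hHir : Hironaka1964_smoothCompactification) (hD : deligne_globalInvariantCycles) : Andre1996_deformation :=
  Andre1996_deformation_holds_of hcurve hHir hD Andre1996_exists_motivated_of_motivated_pullback_holds
    Andre1996_motivatedClasses_pullback_holds

end Part2

end Literature.AlgebraicGeometry.HodgeTheory.MotivatedAlgebra

end
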